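import Literature.MathematicalPhysics.QuantumChemistry.PositivityConditions
import HarnessLib

/-!
# The three-index conditions `T1`, `T2` in anticommutator form: positivity for every state and
# reduction to the one- and two-particle reduced density matrices

Topic `Literature/MathematicalPhysics/QuantumChemistry`; a companion of `PositivityConditions.lean`
(Mazziotti's metric matrices `⟨ψ| C_I C_J† |ψ⟩ ⪰ 0`; the `D`, `Q`, `G`, `T1 = ³D + ³Q`, `T2 = ³E + ³F`
matrices of a Fock-space vector). That file lists as NOT formalised "the statement that `T1`, `T2`
depend on the 2-RDM only (the six-operator terms cancel)". This file PROVES that statement in the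
form in which it holds for an ARBITRARY (complex, unnormalised, any particle content) Fock-space
vector `ψ`, namely for the `T1` and `T2` matrices of Erdahl / Zhao–Braams–Fukuda–Overton–Percus as
printed by Nakata et al. (2008) §II.A — the expectation of the ANTICOMMUTATOR `{C_I, C_J†}`
("`T2` condition is derived by the semidefiniteness of the form `A†A + AA†`", §II.B):

* `T1^{ijk}_{lmn} = ⟨ψ| a†_i a†_j a†_k a_n a_m a_l + a_n a_m a_l a†_i a†_j a†_k |ψ⟩`
  (`C_I = a†_i a†_j a†_k`), and
* `T2^{ijk}_{lmn} = ⟨ψ| a†_i a†_j a_k a†_n a_m a_l + a†_n a_m a_l a†_i a†_j a_k |ψ⟩`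
  (`C_I = a†_i a†_j a_k`).

Contents (all PROVED, 0 sorry, no definitions, no named facts):

* `star_dotProduct_anticomm_mulVec`, `metricMatrix_add_transpose_conjTranspose_posSemidef`: for ANY
  operator family `C_I`, `⟨ψ|{C_I, C_J†}|ψ⟩ = M(C)_{IJ} + M(C†)_{JI}` is the metric matrix of `C` plus the
  TRANSPOSE of the metric matrix of the adjoint family, hence positive semidefinite (Gram + transpose
  of Gram) — Erdahl's `A†A + AA† ⪰ 0` device behind `T1`, `T2` (Nakata et al. (2008) §II.A–B);
* the CAR identities `threeCreate_anticomm_eq` (the anticommutator `{a†_i a†_j a†_k, a_n a_m a_l}` is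
  a polynomial of degree ≤ 4: `9` terms `δ·a†a†aa`, `18` terms `δδ·a†a`, `6` terms `δδδ·1` — the
  antisymmetrised `(1/6) δδδ − (1/2) δδγ + (1/4) δΓ` of Nakata et al. written out) and
  `twoCreateAnnihilate_anticomm_eq` (`{a†_i a†_j a_k, a†_n a_m a_l}`: `5` terms `δ·a†a†aa`, `2` terms
  `δδ·a†a`);
* `t1_entry_eq_rdm`, `t2_entry_eq_rdm`: the `T1` and `T2` matrix entries as EXPLICIT linear functionals
  of `⟨ψ,ψ⟩`, `oneRDM ψ` and `twoRDM ψ` (Nakata et al. (2008) §II.A, the displayed formulas for `T1`,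
  `T2` in terms of `γ`, `Γ`), and `t1Transpose_posSemidef`, `t2Anticomm_posSemidef`: both matrices are
  positive semidefinite for every `ψ`.

CONVENTION NOTE (why "anticommutator form"). In the tree's convention `metricMatrix C ψ I J =
⟨ψ| C_I C_J† |ψ⟩`, the hole part of `T1` written with `C^Q_{ijk} = a_i a_j a_k` (Mazziotti (2007)
eq. (21), vendored as `t1Matrix ψ = ³D + ³Q`) is the TRANSPOSE of the hole part of the anticommutator
form: `t1_transpose_form` below is `³D + ³Qᵀ` (`metricMatrix_conjTranspose_threeCreate`). For the
real-valued wave functions of the quantum-chemistry sources the two matrices coincide (`³Q` is then real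
symmetric); for a general complex `ψ` both are positive semidefinite (`t1Matrix_posSemidef`, resp.
`t1Transpose_posSemidef` here), but only the anticommutator form is a functional of the 2-RDM (the
six-operator parts of `⟨C_I C_J†⟩` and `⟨C_J† C_I⟩` cancel identically, those of `⟨C_I C_J†⟩` and
`⟨C^Q_I C^Q_J†⟩` only up to complex conjugation). The same remark applies to `T2 = ³E + ³F` versus
`t2_entry_eq_rdm`. Kronecker deltas are written `(if x = y then 1 else 0)` with the annihilator index
first, exactly as the normal-ordering rule `a_x a†_y = δ_xy − a†_y a_x` produces them.

What is NOT here: the `T2′` strengthening (Braams–Percus–Zhao 2007 / Mazziotti's `T̄2`; Nakata et al.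
(2008) §II.B), the spin-adapted and fixed-`N` block forms used by SDP codes, and any statement about
sufficiency.

## References
* M. Nakata, B. J. Braams, K. Fujisawa, M. Fukuda, J. K. Percus, M. Yamashita, Z. Zhao, *Variational
  calculation of second-order reduced density matrices by strong `N`-representability conditions and
  an accurate semidefinite programming solver*, J. Chem. Phys. 128 (2008) 164113, §II.A (the `T1`,
  `T2` matrices and their expressions through `γ`, `Γ`), §II.B (`A†A + AA†`).
  [cite: NakataEtAl2008, §II.A]
* D. A. Mazziotti, *Variational two-electron reduced-density-matrix theory*, Adv. Chem. Phys. 134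
  (2007) 21–59, §II.D.2 eqs. (37)–(40) (`T1 = ³D + ³Q`, `T2 = ³E + ³F` "depend only on the 2-RDM
  because the 3-particle parts cancel"). [cite: Mazziotti2007RDMChapter, §II.D.2 eqs. (37)-(40)]
* R. M. Erdahl, Int. J. Quantum Chem. 13 (1978) 697 (the `T1`/`T2` conditions); Z. Zhao, B. J. Braams,
  M. Fukuda, M. L. Overton, J. K. Percus, J. Chem. Phys. 120 (2004) 2095 (their implementation) — cited
  through Nakata et al. (2008) refs. 25–26.
-/

noncomputable section

namespace Literature.MathematicalPhysics.QuantumChemistry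

open Matrix Literature.MathematicalPhysics.QuantumLattice
open scoped ComplexOrder

/-! ### The anticommutator form of a metric matrix is positive semidefinite -/

section General

variable {ι : Type*} [Fintype ι]

/-- **Anticommutator expectation = metric matrix + transposed metric matrix of the adjoints**: for any
operator family `C_I` and vector `ψ`,
`⟨ψ| C_I C_J† + C_J† C_I |ψ⟩ = ⟨ψ|C_I C_J†|ψ⟩ + ⟨ψ|(C†)_J ((C†)_I)†|ψ⟩`, i.e. the `(I, J)` entry of
`M(C) + M(C†)ᵀ` in the notation of `metricMatrix`. This is the matrix of Erdahl's form `A A† + A† A`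
for `A = Σ_I c_I C_I`. Nakata et al. (2008) §II.B ("`T2` condition is derived by the semidefiniteness of
the form `A†A + AA†`"). [cite: NakataEtAl2008, §II.B] -/
theorem star_dotProduct_anticomm_mulVec {m : Type*} (C : m → Matrix (Finset ι) (Finset ι) ℂ)
    (ψ : Fock ι) (I J : m) :
    star ψ ⬝ᵥ (C I * (C J)ᴴ + (C J)ᴴ * C I) *ᵥ ψ =
      metricMatrix C ψ I J + metricMatrix (fun K => (C K)ᴴ) ψ J I := by
  simp only [metricMatrix, conjTranspose_conjTranspose, add_mulVec, dotProduct_add]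

/-- **Erdahl's positivity**: for any operator family `C_I` and any Fock-space vector `ψ` the matrix
`(⟨ψ| C_I C_J† + C_J† C_I |ψ⟩)_{IJ} = M(C) + M(C†)ᵀ` is positive semidefinite — the first summand is
the Gram matrix of the vectors `C_I† ψ`, the second the transpose of the Gram matrix of the vectors
`C_I ψ`. The `T1` and `T2` conditions are the cases `C_I = a†_i a†_j a†_k` and `C_I = a†_i a†_j a_k`.
Nakata et al. (2008) §II.A–B. [cite: NakataEtAl2008, §II.B] -/
theorem metricMatrix_add_transpose_conjTranspose_posSemidef {m : Type*} [Fintype m]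
    (C : m → Matrix (Finset ι) (Finset ι) ℂ) (ψ : Fock ι) :
    (metricMatrix C ψ + (metricMatrix (fun K => (C K)ᴴ) ψ)ᵀ).PosSemidef :=
  (metricMatrix_posSemidef C ψ).add (metricMatrix_posSemidef _ ψ).transpose

/-- Entries of `M(C) + M(C†)ᵀ` are the anticommutator expectations `⟨ψ| C_I C_J† + C_J† C_I |ψ⟩`.
Nakata et al. (2008) §II.B. [cite: NakataEtAl2008, §II.B] -/
theorem metricMatrix_add_transpose_conjTranspose_apply {m : Type*}
    (C : m → Matrix (Finset ι) (Finset ι) ℂ) (ψ : Fock ι) (I J : m) :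
    (metricMatrix C ψ + (metricMatrix (fun K => (C K)ᴴ) ψ)ᵀ) I J =
      star ψ ⬝ᵥ (C I * (C J)ᴴ + (C J)ᴴ * C I) *ᵥ ψ := by
  rw [star_dotProduct_anticomm_mulVec, Matrix.add_apply, Matrix.transpose_apply]

end General

section ThreeIndex

variable {ι : Type*} [LinearOrder ι] [Fintype ι]

/-! ### Reversal of triple products and the adjoint of `a†_i a†_j a†_k` -/

/-- Reversing three annihilators costs a sign: `a_k a_j a_i = −a_i a_j a_k` (three transpositions of
the CAR `a_x a_y = −a_y a_x`; also when indices coincide, both sides being `0`). Essler et al. (2005)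
§2.1 eq. (2.2a). [cite: EsslerEtAl2005, §2.1 eq. (2.2a)] -/
theorem annihilation_triple_reverse (i j k : ι) :
    annihilation k * annihilation j * annihilation i =
      -(annihilation i * annihilation j * annihilation k) := by
  rw [LiebThm1.annihilation_mul_annihilation_eq_neg k j, neg_mul, Matrix.mul_assoc,
    LiebThm1.annihilation_mul_annihilation_eq_neg k i, mul_neg, ← Matrix.mul_assoc,
    LiebThm1.annihilation_mul_annihilation_eq_neg j i, neg_mul, neg_neg]

/-- Reversing three creators costs a sign: `a†_k a†_j a†_i = −a†_i a†_j a†_k`. Essler et al. (2005)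
§2.1 eq. (2.2a). [cite: EsslerEtAl2005, §2.1 eq. (2.2a)] -/
theorem creation_triple_reverse (i j k : ι) :
    creation k * creation j * creation i = -(creation i * creation j * creation k) := by
  rw [creation_mul_creation_eq_neg k j, neg_mul, Matrix.mul_assoc, creation_mul_creation_eq_neg k i,
    mul_neg, ← Matrix.mul_assoc, creation_mul_creation_eq_neg j i, neg_mul, neg_neg]

/-- The adjoint of the triple creator is minus the triple annihilator with the SAME index order:
`(a†_i a†_j a†_k)† = a_k a_j a_i = −a_i a_j a_k`, i.e. `(C^D_{ijk})† = −C^Q_{ijk}` for Mazziotti's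
operators (2007) eqs. (18), (21). [cite: Mazziotti2007RDMChapter, §II.C eqs. (18), (21)] -/
theorem conjTranspose_threeCreate (t : ι × ι × ι) : (threeCreate t)ᴴ = -threeAnnihilate t := by
  simp only [threeCreate, threeAnnihilate, conjTranspose_mul, creation_conjTranspose, ← Matrix.mul_assoc]
  exact annihilation_triple_reverse _ _ _

/-- Consequently the metric matrix of the adjoint family `(a†_i a†_j a†_k)†` IS Mazziotti's three-hole
matrix `³Q` (the two signs cancel): `M((C^D)†) = M(C^Q) = ³Q`. Mazziotti (2007) eq. (21).
[cite: Mazziotti2007RDMChapter, §II.C eq. (21)] -/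
theorem metricMatrix_conjTranspose_threeCreate (ψ : Fock ι) :
    metricMatrix (fun t : ι × ι × ι => (threeCreate t)ᴴ) ψ = metricMatrix threeAnnihilate ψ := by
  ext I J
  simp only [metricMatrix, conjTranspose_threeCreate, conjTranspose_neg, neg_mul_neg]

/-- **The `T1` matrix in anticommutator form is positive semidefinite for every state**:
`³D + ³Qᵀ ⪰ 0`, where `³D = M(a†a†a†)` and `³Q = M(a a a)` are Mazziotti's three-particle and three-hole
metric matrices; entrywise this is the matrix
`⟨ψ| a†_i a†_j a†_k a_n a_m a_l + a_n a_m a_l a†_i a†_j a†_k |ψ⟩` of Nakata et al. (2008) §II.A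
(`t1_transpose_form_apply`). [cite: NakataEtAl2008, §II.A] -/
theorem t1Transpose_posSemidef (ψ : Fock ι) :
    (metricMatrix threeCreate ψ + (metricMatrix threeAnnihilate ψ)ᵀ).PosSemidef := by
  rw [← metricMatrix_conjTranspose_threeCreate]
  exact metricMatrix_add_transpose_conjTranspose_posSemidef _ ψ

/-- The word behind the `(I, J)` entry of `³D`: `C^D_I (C^D_J)† = a†_i a†_j a†_k a_n a_m a_l` for
`I = (i,j,k)`, `J = (l,m,n)`. Mazziotti (2007) eq. (18). [cite: Mazziotti2007RDMChapter, §II.C eq. (18)] -/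
theorem threeCreate_mul_conjTranspose_threeCreate (i j k l m n : ι) :
    threeCreate (i, j, k) * (threeCreate (l, m, n))ᴴ =
      creation i * creation j * creation k * annihilation n * annihilation m * annihilation l := by
  simp only [threeCreate, conjTranspose_mul, creation_conjTranspose, ← Matrix.mul_assoc]

/-- The word behind the `(J, I)` entry of `M((C^D)†)`: `(C^D_J)† C^D_I = a_n a_m a_l a†_i a†_j a†_k`.
Mazziotti (2007) eq. (18). [cite: Mazziotti2007RDMChapter, §II.C eq. (18)] -/
theorem conjTranspose_threeCreate_mul_threeCreate (i j k l m n : ι) :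
    (threeCreate (l, m, n))ᴴ * threeCreate (i, j, k) =
      annihilation n * annihilation m * annihilation l * creation i * creation j * creation k := by
  simp only [threeCreate, conjTranspose_mul, creation_conjTranspose, ← Matrix.mul_assoc]

/-- Entries of the anticommutator-form `T1` matrix: `(³D + ³Qᵀ)_{IJ} =
⟨ψ| a†_i a†_j a†_k a_n a_m a_l + a_n a_m a_l a†_i a†_j a†_k |ψ⟩` — the `T1` matrix element printed
by Nakata et al. (2008) §II.A. [cite: NakataEtAl2008, §II.A] -/
theorem t1_transpose_form_apply (ψ : Fock ι) (i j k l m n : ι) :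
    (metricMatrix threeCreate ψ + (metricMatrix threeAnnihilate ψ)ᵀ) (i, j, k) (l, m, n) =
      star ψ ⬝ᵥ (creation i * creation j * creation k * annihilation n * annihilation m * annihilation l +
        annihilation n * annihilation m * annihilation l * creation i * creation j * creation k) *ᵥ ψ := by
  rw [← metricMatrix_conjTranspose_threeCreate, metricMatrix_add_transpose_conjTranspose_apply,
    threeCreate_mul_conjTranspose_threeCreate, conjTranspose_threeCreate_mul_threeCreate]

/-! ### `T1`: the anticommutator `{a†_i a†_j a†_k, a_n a_m a_l}` has degree ≤ 4 -/

/-- **The `T1` operator identity** (normal ordering of `a_n a_m a_l a†_i a†_j a†_k` by the CAR; the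
two six-operator terms cancel): `a†_i a†_j a†_k a_n a_m a_l + a_n a_m a_l a†_i a†_j a†_k` equals the
sum over the `9` single contractions `± δ a†a†aa`, the `18` double contractions `± δδ a†a`, and the `6`
triple contractions `± δδδ` (signs = signs of the matching permutations). This is the operator form of
Nakata et al. (2008) §II.A's `T1 = A[i]A[j]((1/6) δδδ − (1/2) δδγ + (1/4) δΓ)`. [cite: NakataEtAl2008, §II.A] -/
theorem threeCreate_anticomm_eq (i j k l m n : ι) :
    creation i * creation j * creation k * annihilation n * annihilation m * annihilation l +
        annihilation n * annihilation m * annihilation l * creation i * creation j * creation k =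
      (if l = i then (1 : ℂ) else 0) • (creation j * creation k * annihilation n * annihilation m)
      - (if l = j then (1 : ℂ) else 0) • (creation i * creation k * annihilation n * annihilation m)
      + (if l = k then (1 : ℂ) else 0) • (creation i * creation j * annihilation n * annihilation m)
      - (if m = i then (1 : ℂ) else 0) • (creation j * creation k * annihilation n * annihilation l)
      + (if m = j then (1 : ℂ) else 0) • (creation i * creation k * annihilation n * annihilation l)
      - (if m = k then (1 : ℂ) else 0) • (creation i * creation j * annihilation n * annihilation l)
      + (if n = i then (1 : ℂ) else 0) • (creation j * creation k * annihilation m * annihilation l)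
      - (if n = j then (1 : ℂ) else 0) • (creation i * creation k * annihilation m * annihilation l)
      + (if n = k then (1 : ℂ) else 0) • (creation i * creation j * annihilation m * annihilation l)
      - ((if l = i then (1 : ℂ) else 0) * (if m = j then (1 : ℂ) else 0)) • (creation k * annihilation n)
      + ((if l = i then (1 : ℂ) else 0) * (if m = k then (1 : ℂ) else 0)) • (creation j * annihilation n)
      + ((if l = i then (1 : ℂ) else 0) * (if n = j then (1 : ℂ) else 0)) • (creation k * annihilation m)
      - ((if l = i then (1 : ℂ) else 0) * (if n = k then (1 : ℂ) else 0)) • (creation j * annihilation m)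
      + ((if l = j then (1 : ℂ) else 0) * (if m = i then (1 : ℂ) else 0)) • (creation k * annihilation n)
      - ((if l = j then (1 : ℂ) else 0) * (if m = k then (1 : ℂ) else 0)) • (creation i * annihilation n)
      - ((if l = j then (1 : ℂ) else 0) * (if n = i then (1 : ℂ) else 0)) • (creation k * annihilation m)
      + ((if l = j then (1 : ℂ) else 0) * (if n = k then (1 : ℂ) else 0)) • (creation i * annihilation m)
      - ((if l = k then (1 : ℂ) else 0) * (if m = i then (1 : ℂ) else 0)) • (creation j * annihilation n)
      + ((if l = k then (1 : ℂ) else 0) * (if m = j then (1 : ℂ) else 0)) • (creation i * annihilation n)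
      + ((if l = k then (1 : ℂ) else 0) * (if n = i then (1 : ℂ) else 0)) • (creation j * annihilation m)
      - ((if l = k then (1 : ℂ) else 0) * (if n = j then (1 : ℂ) else 0)) • (creation i * annihilation m)
      - ((if m = i then (1 : ℂ) else 0) * (if n = j then (1 : ℂ) else 0)) • (creation k * annihilation l)
      + ((if m = i then (1 : ℂ) else 0) * (if n = k then (1 : ℂ) else 0)) • (creation j * annihilation l)
      + ((if m = j then (1 : ℂ) else 0) * (if n = i then (1 : ℂ) else 0)) • (creation k * annihilation l)
      - ((if m = j then (1 : ℂ) else 0) * (if n = k then (1 : ℂ) else 0)) • (creation i * annihilation l)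
      - ((if m = k then (1 : ℂ) else 0) * (if n = i then (1 : ℂ) else 0)) • (creation j * annihilation l)
      + ((if m = k then (1 : ℂ) else 0) * (if n = j then (1 : ℂ) else 0)) • (creation i * annihilation l)
      + ((if l = i then (1 : ℂ) else 0) * (if m = j then (1 : ℂ) else 0) * (if n = k then (1 : ℂ) else 0)) •
          (1 : Matrix (Finset ι) (Finset ι) ℂ)
      - ((if l = i then (1 : ℂ) else 0) * (if m = k then (1 : ℂ) else 0) * (if n = j then (1 : ℂ) else 0)) •
          (1 : Matrix (Finset ι) (Finset ι) ℂ)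
      - ((if l = j then (1 : ℂ) else 0) * (if m = i then (1 : ℂ) else 0) * (if n = k then (1 : ℂ) else 0)) •
          (1 : Matrix (Finset ι) (Finset ι) ℂ)
      + ((if l = j then (1 : ℂ) else 0) * (if m = k then (1 : ℂ) else 0) * (if n = i then (1 : ℂ) else 0)) •
          (1 : Matrix (Finset ι) (Finset ι) ℂ)
      + ((if l = k then (1 : ℂ) else 0) * (if m = i then (1 : ℂ) else 0) * (if n = j then (1 : ℂ) else 0)) •
          (1 : Matrix (Finset ι) (Finset ι) ℂ)
      - ((if l = k then (1 : ℂ) else 0) * (if m = j then (1 : ℂ) else 0) * (if n = i then (1 : ℂ) else 0)) •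
          (1 : Matrix (Finset ι) (Finset ι) ℂ) := by
  simp only [mul_annihilation_mul_creation_smul, annihilation_mul_creation_smul, Matrix.sub_mul,
    smul_mul_assoc, Matrix.one_mul, smul_sub, smul_smul]
  module

/-- **`T1` is a functional of the 2-RDM** (Nakata et al. (2008) §II.A, the displayed expression of
`T1` through `γ` and `Γ`; Mazziotti (2007) eq. (39)): for every Fock-space vector `ψ` and all indices,
the `T1` entry `(³D + ³Qᵀ)^{ijk}_{lmn} = ⟨ψ|{a†_i a†_j a†_k, a_n a_m a_l}|ψ⟩` equals
`Σ ±δ ²D + Σ ±δδ ¹D + Σ ±δδδ ⟨ψ,ψ⟩` with the `9 + 18 + 6` terms below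
(`¹D^x_y = oneRDM ψ x y`, `²D^{xy}_{zw} = twoRDM ψ (x,y) (z,w)`; no normalisation of `ψ` assumed).
[cite: NakataEtAl2008, §II.A] -/
theorem t1_entry_eq_rdm (ψ : Fock ι) (i j k l m n : ι) :
    (metricMatrix threeCreate ψ + (metricMatrix threeAnnihilate ψ)ᵀ) (i, j, k) (l, m, n) =
      (if l = i then (1 : ℂ) else 0) * twoRDM ψ (j, k) (m, n)
      - (if l = j then (1 : ℂ) else 0) * twoRDM ψ (i, k) (m, n)
      + (if l = k then (1 : ℂ) else 0) * twoRDM ψ (i, j) (m, n)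
      - (if m = i then (1 : ℂ) else 0) * twoRDM ψ (j, k) (l, n)
      + (if m = j then (1 : ℂ) else 0) * twoRDM ψ (i, k) (l, n)
      - (if m = k then (1 : ℂ) else 0) * twoRDM ψ (i, j) (l, n)
      + (if n = i then (1 : ℂ) else 0) * twoRDM ψ (j, k) (l, m)
      - (if n = j then (1 : ℂ) else 0) * twoRDM ψ (i, k) (l, m)
      + (if n = k then (1 : ℂ) else 0) * twoRDM ψ (i, j) (l, m)
      - (if l = i then (1 : ℂ) else 0) * (if m = j then (1 : ℂ) else 0) * oneRDM ψ k n
      + (if l = i then (1 : ℂ) else 0) * (if m = k then (1 : ℂ) else 0) * oneRDM ψ j n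
      + (if l = i then (1 : ℂ) else 0) * (if n = j then (1 : ℂ) else 0) * oneRDM ψ k m
      - (if l = i then (1 : ℂ) else 0) * (if n = k then (1 : ℂ) else 0) * oneRDM ψ j m
      + (if l = j then (1 : ℂ) else 0) * (if m = i then (1 : ℂ) else 0) * oneRDM ψ k n
      - (if l = j then (1 : ℂ) else 0) * (if m = k then (1 : ℂ) else 0) * oneRDM ψ i n
      - (if l = j then (1 : ℂ) else 0) * (if n = i then (1 : ℂ) else 0) * oneRDM ψ k m
      + (if l = j then (1 : ℂ) else 0) * (if n = k then (1 : ℂ) else 0) * oneRDM ψ i m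
      - (if l = k then (1 : ℂ) else 0) * (if m = i then (1 : ℂ) else 0) * oneRDM ψ j n
      + (if l = k then (1 : ℂ) else 0) * (if m = j then (1 : ℂ) else 0) * oneRDM ψ i n
      + (if l = k then (1 : ℂ) else 0) * (if n = i then (1 : ℂ) else 0) * oneRDM ψ j m
      - (if l = k then (1 : ℂ) else 0) * (if n = j then (1 : ℂ) else 0) * oneRDM ψ i m
      - (if m = i then (1 : ℂ) else 0) * (if n = j then (1 : ℂ) else 0) * oneRDM ψ k l
      + (if m = i then (1 : ℂ) else 0) * (if n = k then (1 : ℂ) else 0) * oneRDM ψ j l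
      + (if m = j then (1 : ℂ) else 0) * (if n = i then (1 : ℂ) else 0) * oneRDM ψ k l
      - (if m = j then (1 : ℂ) else 0) * (if n = k then (1 : ℂ) else 0) * oneRDM ψ i l
      - (if m = k then (1 : ℂ) else 0) * (if n = i then (1 : ℂ) else 0) * oneRDM ψ j l
      + (if m = k then (1 : ℂ) else 0) * (if n = j then (1 : ℂ) else 0) * oneRDM ψ i l
      + (if l = i then (1 : ℂ) else 0) * (if m = j then (1 : ℂ) else 0) * (if n = k then (1 : ℂ) else 0) *
          (star ψ ⬝ᵥ ψ)
      - (if l = i then (1 : ℂ) else 0) * (if m = k then (1 : ℂ) else 0) * (if n = j then (1 : ℂ) else 0) *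
          (star ψ ⬝ᵥ ψ)
      - (if l = j then (1 : ℂ) else 0) * (if m = i then (1 : ℂ) else 0) * (if n = k then (1 : ℂ) else 0) *
          (star ψ ⬝ᵥ ψ)
      + (if l = j then (1 : ℂ) else 0) * (if m = k then (1 : ℂ) else 0) * (if n = i then (1 : ℂ) else 0) *
          (star ψ ⬝ᵥ ψ)
      + (if l = k then (1 : ℂ) else 0) * (if m = i then (1 : ℂ) else 0) * (if n = j then (1 : ℂ) else 0) *
          (star ψ ⬝ᵥ ψ)
      - (if l = k then (1 : ℂ) else 0) * (if m = j then (1 : ℂ) else 0) * (if n = i then (1 : ℂ) else 0) *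
          (star ψ ⬝ᵥ ψ) := by
  rw [t1_transpose_form_apply, threeCreate_anticomm_eq]
  simp only [oneRDM, twoRDM, sub_mulVec, add_mulVec, smul_mulVec, one_mulVec, dotProduct_sub,
    dotProduct_add, dotProduct_smul, smul_eq_mul]

/-! ### `T2`: the anticommutator `{a†_i a†_j a_k, a†_n a_m a_l}` has degree ≤ 4 -/

/-- Cyclic reordering of the six-operator word produced by normal ordering `a†_n a_m a_l a†_i a†_j a_k`:
`a†_n a†_i a†_j a_m a_l a_k = a†_i a†_j a†_n a_k a_m a_l` (two transpositions among the creators,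
two among the annihilators: no net sign). Essler et al. (2005) §2.1 eq. (2.2a).
[cite: EsslerEtAl2005, §2.1 eq. (2.2a)] -/
theorem creation_creation_creation_annihilation_cyclic (i j k l m n : ι) :
    creation n * creation i * creation j * annihilation m * annihilation l * annihilation k =
      creation i * creation j * creation n * annihilation k * annihilation m * annihilation l := by
  have h1 : creation n * creation i * creation j = creation i * creation j * creation n := by
    rw [creation_mul_creation_eq_neg n i, neg_mul, Matrix.mul_assoc, creation_mul_creation_eq_neg n j,
      mul_neg, neg_neg, ← Matrix.mul_assoc]
  have h2 : annihilation m * annihilation l * annihilation k =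
      annihilation k * annihilation m * annihilation l := by
    rw [Matrix.mul_assoc, LiebThm1.annihilation_mul_annihilation_eq_neg l k, mul_neg,
      ← Matrix.mul_assoc, LiebThm1.annihilation_mul_annihilation_eq_neg m k, neg_mul, neg_neg]
  calc creation n * creation i * creation j * annihilation m * annihilation l * annihilation k
      = (creation n * creation i * creation j) * (annihilation m * annihilation l * annihilation k) := by
        simp only [Matrix.mul_assoc]
    _ = (creation i * creation j * creation n) * (annihilation k * annihilation m * annihilation l) := by
        rw [h1, h2]
    _ = creation i * creation j * creation n * annihilation k * annihilation m * annihilation l := by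
        simp only [Matrix.mul_assoc]

/-- **The `T2` operator identity** (normal ordering by the CAR; the six-operator terms cancel after the
cyclic reordering `creation_creation_creation_annihilation_cyclic`):
`a†_i a†_j a_k a†_n a_m a_l + a†_n a_m a_l a†_i a†_j a_k
  = δ_kn a†_i a†_j a_m a_l − δ_li a†_n a†_j a_m a_k + δ_lj a†_n a†_i a_m a_k + δ_mi a†_n a†_j a_l a_k
    − δ_mj a†_n a†_i a_l a_k + (δ_li δ_mj − δ_lj δ_mi) a†_n a_k` —
the operator form of Nakata et al. (2008) §II.A's expression of `T2` through `γ`, `Γ`.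
[cite: NakataEtAl2008, §II.A] -/
theorem twoCreateAnnihilate_anticomm_eq (i j k l m n : ι) :
    creation i * creation j * annihilation k * creation n * annihilation m * annihilation l +
        creation n * annihilation m * annihilation l * creation i * creation j * annihilation k =
      (if k = n then (1 : ℂ) else 0) • (creation i * creation j * annihilation m * annihilation l)
      - (if l = i then (1 : ℂ) else 0) • (creation n * creation j * annihilation m * annihilation k)
      + (if l = j then (1 : ℂ) else 0) • (creation n * creation i * annihilation m * annihilation k)
      + (if m = i then (1 : ℂ) else 0) • (creation n * creation j * annihilation l * annihilation k)
      - (if m = j then (1 : ℂ) else 0) • (creation n * creation i * annihilation l * annihilation k)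
      + ((if l = i then (1 : ℂ) else 0) * (if m = j then (1 : ℂ) else 0)) • (creation n * annihilation k)
      - ((if l = j then (1 : ℂ) else 0) * (if m = i then (1 : ℂ) else 0)) • (creation n * annihilation k) := by
  simp only [mul_annihilation_mul_creation_smul, Matrix.sub_mul, smul_mul_assoc, smul_sub, smul_smul,
    creation_creation_creation_annihilation_cyclic]
  module

/-- The word behind the `(I, J)` entry of `³E = M(a†a†a)`: `C^E_I (C^E_J)† = a†_i a†_j a_k a†_n a_m a_l`
for `I = (i,j,k)`, `J = (l,m,n)`. Mazziotti (2007) eq. (19). [cite: Mazziotti2007RDMChapter, §II.C eq. (19)] -/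
theorem twoCreateAnnihilate_mul_conjTranspose (i j k l m n : ι) :
    twoCreateAnnihilate (i, j, k) * (twoCreateAnnihilate (l, m, n))ᴴ =
      creation i * creation j * annihilation k * creation n * annihilation m * annihilation l := by
  simp only [twoCreateAnnihilate, conjTranspose_mul, creation_conjTranspose, annihilation_conjTranspose,
    ← Matrix.mul_assoc]

/-- The word behind the `(J, I)` entry of `M((C^E)†)`: `(C^E_J)† C^E_I = a†_n a_m a_l a†_i a†_j a_k`.
Mazziotti (2007) eq. (19). [cite: Mazziotti2007RDMChapter, §II.C eq. (19)] -/
theorem conjTranspose_twoCreateAnnihilate_mul (i j k l m n : ι) :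
    (twoCreateAnnihilate (l, m, n))ᴴ * twoCreateAnnihilate (i, j, k) =
      creation n * annihilation m * annihilation l * creation i * creation j * annihilation k := by
  simp only [twoCreateAnnihilate, conjTranspose_mul, creation_conjTranspose, annihilation_conjTranspose,
    ← Matrix.mul_assoc]

/-- **The `T2` matrix (anticommutator form) is positive semidefinite for every state**:
`(⟨ψ| a†_i a†_j a_k a†_n a_m a_l + a†_n a_m a_l a†_i a†_j a_k |ψ⟩)_{(ijk),(lmn)} = ³E + M((C^E)†)ᵀ ⪰ 0`.
Nakata et al. (2008) §II.A (`T2`), §II.B (`A†A + AA†`). [cite: NakataEtAl2008, §II.A] -/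
theorem t2Anticomm_posSemidef (ψ : Fock ι) :
    (metricMatrix twoCreateAnnihilate ψ +
      (metricMatrix (fun t : ι × ι × ι => (twoCreateAnnihilate t)ᴴ) ψ)ᵀ).PosSemidef :=
  metricMatrix_add_transpose_conjTranspose_posSemidef _ ψ

/-- Entries of the anticommutator-form `T2` matrix as printed by Nakata et al. (2008) §II.A:
`T2^{ijk}_{lmn} = ⟨ψ| a†_i a†_j a_k a†_n a_m a_l + a†_n a_m a_l a†_i a†_j a_k |ψ⟩`.
[cite: NakataEtAl2008, §II.A] -/
theorem t2_anticomm_form_apply (ψ : Fock ι) (i j k l m n : ι) :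
    (metricMatrix twoCreateAnnihilate ψ +
        (metricMatrix (fun t : ι × ι × ι => (twoCreateAnnihilate t)ᴴ) ψ)ᵀ) (i, j, k) (l, m, n) =
      star ψ ⬝ᵥ (creation i * creation j * annihilation k * creation n * annihilation m * annihilation l +
        creation n * annihilation m * annihilation l * creation i * creation j * annihilation k) *ᵥ ψ := by
  rw [metricMatrix_add_transpose_conjTranspose_apply, twoCreateAnnihilate_mul_conjTranspose,
    conjTranspose_twoCreateAnnihilate_mul]

/-- **`T2` is a functional of the 2-RDM** (Nakata et al. (2008) §II.A, the displayed expression of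
`T2` through `γ` and `Γ`; Mazziotti (2007) eq. (40)): for every Fock-space vector `ψ` and all indices,
`T2^{ijk}_{lmn} = δ_kn ²D^{ij}_{lm} − δ_li ²D^{nj}_{km} + δ_lj ²D^{ni}_{km} + δ_mi ²D^{nj}_{kl} − δ_mj ²D^{ni}_{kl}
  + (δ_li δ_mj − δ_lj δ_mi) ¹D^n_k`
(`¹D^x_y = oneRDM ψ x y`, `²D^{xy}_{zw} = twoRDM ψ (x,y) (z,w) = ⟨a†_x a†_y a_w a_z⟩`).
[cite: NakataEtAl2008, §II.A] -/
theorem t2_entry_eq_rdm (ψ : Fock ι) (i j k l m n : ι) :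
    (metricMatrix twoCreateAnnihilate ψ +
        (metricMatrix (fun t : ι × ι × ι => (twoCreateAnnihilate t)ᴴ) ψ)ᵀ) (i, j, k) (l, m, n) =
      (if k = n then (1 : ℂ) else 0) * twoRDM ψ (i, j) (l, m)
      - (if l = i then (1 : ℂ) else 0) * twoRDM ψ (n, j) (k, m)
      + (if l = j then (1 : ℂ) else 0) * twoRDM ψ (n, i) (k, m)
      + (if m = i then (1 : ℂ) else 0) * twoRDM ψ (n, j) (k, l)
      - (if m = j then (1 : ℂ) else 0) * twoRDM ψ (n, i) (k, l)
      + (if l = i then (1 : ℂ) else 0) * (if m = j then (1 : ℂ) else 0) * oneRDM ψ n k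
      - (if l = j then (1 : ℂ) else 0) * (if m = i then (1 : ℂ) else 0) * oneRDM ψ n k := by
  rw [t2_anticomm_form_apply, twoCreateAnnihilate_anticomm_eq]
  simp only [oneRDM, twoRDM, sub_mulVec, add_mulVec, smul_mulVec, dotProduct_sub, dotProduct_add,
    dotProduct_smul, smul_eq_mul]

end ThreeIndex

end Literature.MathematicalPhysics.QuantumChemistry

end
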